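import Mathlib
import Literature.Analysis.SpecialFunctions.LegendrePolynomialsBonnet
import Literature.Analysis.SpecialFunctions.LegendreZeros

/-!
# Gauss–Legendre quadrature: exactness in degree `≤ 2n - 1`, positive weights

The `n`-point Gauss–Legendre rule: nodes = the `n` zeros `x₁ < … < x_n` of the Legendre
polynomial `P_n` in `(-1, 1)` (`LegendreZeros.lean`: `legendre_roots`), weights (Christoffel
numbers) `λᵢ = ∫_{-1}^{1} ℓᵢ`, where `ℓᵢ` is the Lagrange fundamental polynomial of the node `xᵢ`.

* `integral_eq_sum_gaussLegendreWeight_mul` — for every real polynomial `f` with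
  `deg f ≤ 2n - 1`, `∫_{-1}^{1} f(t) dt = ∑ᵢ λᵢ f(xᵢ)` (Gauss–Jacobi mechanical quadrature, the
  case `dα = dx` on `[-1, 1]`: Szegő, *Orthogonal Polynomials*, Thm. 3.4.1; Castillo–Petronilho,
  *A First Course on Orthogonal Polynomials*, Thm. 3.4 eq. (3.23));
* `gaussLegendreWeight_pos` — `λᵢ > 0` (Szegő Thm. 3.4.2; Castillo–Petronilho Thm. 3.4);
* `sum_gaussLegendreWeight` — `∑ᵢ λᵢ = 2` (Castillo–Petronilho Thm. 3.4 eq. (3.24));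
* `gaussLegendreWeight_eq` — the closed form `λᵢ = 2 / ((1 - xᵢ²) P_n'(xᵢ)²)`
  (Abramowitz–Stegun 25.4.29; Beu, *Introduction to Numerical Programming*, (10.71)), and
  `eval_derivative_legendre_ne_zero_of_mem_gaussLegendreNodes` (`P_n'(xᵢ) ≠ 0`).

The proof is the printed one (Castillo–Petronilho p. 42): interpolate `f` at the nodes by
`r = ∑ᵢ f(xᵢ) ℓᵢ` (Mathlib's `Lagrange.interpolate`), `deg r < n`; `f - r` vanishes at the `n`
simple zeros of `P_n`, so `f - r = P_n · h` with `deg h < n` and `∫ P_n h = 0` by orthogonality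
(`integral_legendre_mul_eq_zero`); hence `∫ f = ∫ r = ∑ᵢ f(xᵢ) ∫ ℓᵢ`.  Positivity: apply
exactness to `ℓᵢ²` (`deg = 2n - 2`): `0 < ∫ ℓᵢ² = ∑ⱼ λⱼ ℓᵢ(xⱼ)² = λᵢ`.  Sum: apply it to `f = 1`.
Closed form (Beu's derivation, pp. 346–347): with `Q = P_n / (X - xᵢ)` one has `Q(xᵢ) = P_n'(xᵢ)`,
`Q(xⱼ) = 0` (`j ≠ i`) and the polynomial identity `Q² = 2 Q P_n' - (Q P_n)'`; integrate, apply
exactness to `Q²` and to `Q P_n'` (degree `2n - 2`) and use `P_n(±1)² = 1`: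
`λᵢ P_n'(xᵢ)² = 2 λᵢ P_n'(xᵢ)² - 2 / (1 - xᵢ²)`.

NOT here: the remainder term for non-polynomial integrands, and asymptotics of nodes/weights.

## Main definitions and results (namespace `Literature.Analysis.SpecialFunctions`)

* `gaussLegendreNodes n : Finset ℝ` (`card = n`, `mem_gaussLegendreNodes_iff`, all in
  `Ioo (-1) 1`), `gaussLegendreBasis n x` (`ℓ_x`; `eval … x = 1`, `eval … y = 0` at the other
  nodes, `natDegree = n - 1`), `gaussLegendreWeight n x` (`λ_x`).
* `integral_eq_sum_gaussLegendreWeight_mul`, `gaussLegendreWeight_pos`, `sum_gaussLegendreWeight`,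
  `gaussLegendreWeight_eq`, `eval_derivative_legendre_ne_zero_of_mem_gaussLegendreNodes`.

## References

* G. Szegő, *Orthogonal Polynomials*, AMS Colloquium Publications 23 (1939; 4th ed. 1975),
  Thm. 3.4.1 (Gauss–Jacobi mechanical quadrature), Thm. 3.4.2 (Christoffel numbers are
  positive). [cite: Szego1939, Thm. 3.4.1]
* K. Castillo, J. Petronilho, *A First Course on Orthogonal Polynomials*, Chapman and Hall/CRC
  (2024), Thm. 3.4 (Gauss–Jacobi Mechanical Quadrature), p. 42 of the held copy — statement and
  the proof followed here. [cite: CastilloPetronilho2024, Thm. 3.4]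
* M. Abramowitz, I. A. Stegun (eds.), *Handbook of Mathematical Functions*, NBS AMS 55 (1964),
  formula 25.4.29 (Gauss–Legendre: `wᵢ = 2 / ((1 - xᵢ²) [P_n'(xᵢ)]²)`).
  [cite: AbramowitzStegun1964, 25.4.29]
* T. A. Beu, *Introduction to Numerical Programming*, CRC Press (2014), §10.8, eqs. (10.66)–(10.71),
  pp. 346–347 of the held copy — the derivation of the closed form followed here.
  [cite: Beu2014, (10.71)]

AI-produced formalisation (H21 engines group, seat eng-cap-1, 2026-08-20: the theorem behind the
engines' Gauss–Legendre rule `cap.special.gauss_legendre` / `cap.quad1d.gl`); no facts, no axioms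
beyond Mathlib's, no `sorry`.
-/

open Polynomial Set

namespace Literature.Analysis.SpecialFunctions

/-- The Gauss–Legendre nodes of order `n`: the `n` zeros of `P_n`, as a `Finset`.
[cite: CastilloPetronilho2024, Thm. 3.4] -/
noncomputable def gaussLegendreNodes (n : ℕ) : Finset ℝ := (legendre n).roots.toFinset

/-- There are exactly `n` Gauss–Legendre nodes of order `n`. [cite: Szego1939, Thm. 3.3.1] -/
theorem card_gaussLegendreNodes (n : ℕ) : (gaussLegendreNodes n).card = n := by
  classical
  exact (legendre_roots n).1

/-- The nodes are exactly the zeros of `P_n`. [cite: CastilloPetronilho2024, Thm. 3.4] -/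
theorem mem_gaussLegendreNodes_iff {n : ℕ} {x : ℝ} :
    x ∈ gaussLegendreNodes n ↔ (legendre n).IsRoot x := by
  classical
  rw [gaussLegendreNodes, Multiset.mem_toFinset, mem_roots (legendre_ne_zero n)]

/-- Every node lies in `(-1, 1)`. [cite: Szego1939, Thm. 3.3.1] -/
theorem mem_Ioo_of_mem_gaussLegendreNodes {n : ℕ} {x : ℝ} (hx : x ∈ gaussLegendreNodes n) :
    x ∈ Ioo (-1 : ℝ) 1 :=
  mem_Ioo_of_isRoot_legendre (mem_gaussLegendreNodes_iff.mp hx)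

/-- The Lagrange fundamental polynomial `ℓ_x` of the node `x` over the node set.
[cite: CastilloPetronilho2024, Thm. 3.4] -/
noncomputable def gaussLegendreBasis (n : ℕ) (x : ℝ) : ℝ[X] :=
  Lagrange.basis (gaussLegendreNodes n) id x

/-- `ℓ_x(x) = 1`. [cite: CastilloPetronilho2024, Thm. 3.4 (proof: ℓ_{j,n}(x_{n,k}) = δ_{jk})] -/
theorem eval_gaussLegendreBasis_self {n : ℕ} {x : ℝ} (hx : x ∈ gaussLegendreNodes n) :
    (gaussLegendreBasis n x).eval x = 1 :=
  Lagrange.eval_basis_self (v := id) (Set.injOn_id _) hx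

/-- `ℓ_x(y) = 0` at every other node `y`.
[cite: CastilloPetronilho2024, Thm. 3.4 (proof: ℓ_{j,n}(x_{n,k}) = δ_{jk})] -/
theorem eval_gaussLegendreBasis_of_ne {n : ℕ} {x y : ℝ} (hy : y ∈ gaussLegendreNodes n)
    (hxy : x ≠ y) : (gaussLegendreBasis n x).eval y = 0 :=
  Lagrange.eval_basis_of_ne (v := id) hxy hy

/-- `deg ℓ_x = n - 1`. [cite: CastilloPetronilho2024, Thm. 3.4 (proof: ℓ_{j,n} ∈ 𝒫_{n-1})] -/
theorem natDegree_gaussLegendreBasis {n : ℕ} {x : ℝ} (hx : x ∈ gaussLegendreNodes n) :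
    (gaussLegendreBasis n x).natDegree = n - 1 := by
  rw [gaussLegendreBasis, Lagrange.natDegree_basis (Set.injOn_id _) hx, card_gaussLegendreNodes]

/-- **The Gauss–Legendre weight** (Christoffel number) of the node `x`:
`λ_x = ∫_{-1}^{1} ℓ_x(t) dt`. [cite: CastilloPetronilho2024, Thm. 3.4 eq. (3.25)] -/
noncomputable def gaussLegendreWeight (n : ℕ) (x : ℝ) : ℝ :=
  ∫ t in (-1 : ℝ)..1, (gaussLegendreBasis n x).eval t

/-- **Gauss–Legendre quadrature is exact in degree `≤ 2n - 1`** (Gauss–Jacobi mechanical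
quadrature: Szegő Thm. 3.4.1; Castillo–Petronilho Thm. 3.4 eq. (3.23), the case `dα = dx` on
`[-1, 1]`): for every real polynomial `f` with `deg f < 2n`,
`∫_{-1}^{1} f = ∑_{x ∈ nodes} λ_x f(x)`.  Proof as printed: Lagrange-interpolate `f` at the
nodes; the difference vanishes at the `n` simple zeros of `P_n`, so it is `P_n · h` with
`deg h < n`, which integrates to `0` by orthogonality (`integral_legendre_mul_eq_zero`).
[cite: Szego1939, Thm. 3.4.1] [cite: CastilloPetronilho2024, Thm. 3.4] -/
theorem integral_eq_sum_gaussLegendreWeight_mul {n : ℕ} {f : ℝ[X]} (hf : f.natDegree < 2 * n) :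
    ∫ t in (-1 : ℝ)..1, f.eval t =
      ∑ x ∈ gaussLegendreNodes n, gaussLegendreWeight n x * f.eval x := by
  classical
  have hvs : Set.InjOn (id : ℝ → ℝ) (gaussLegendreNodes n : Set ℝ) := Set.injOn_id _
  have hcard : (gaussLegendreNodes n).card = n := card_gaussLegendreNodes n
  obtain ⟨r, hr_def⟩ :
      ∃ r : ℝ[X], r = Lagrange.interpolate (gaussLegendreNodes n) id (fun x => f.eval x) :=
    ⟨_, rfl⟩
  have hr_eval : ∀ x ∈ gaussLegendreNodes n, r.eval x = f.eval x := fun x hx => by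
    rw [hr_def]
    exact Lagrange.eval_interpolate_at_node _ hvs hx
  have hr_deg : r.degree < n := by
    have := Lagrange.degree_interpolate_lt (fun x => f.eval x) hvs
    rwa [hcard, ← hr_def] at this
  -- `P_n ∣ f - r`
  have hdvd : legendre n ∣ f - r := by
    rw [legendre_eq_C_mul_prod_roots n,
      C_mul_dvd (leadingCoeff_ne_zero.mpr (legendre_ne_zero n))]
    by_cases hg : f - r = 0
    · rw [hg]; exact dvd_zero _
    rw [Multiset.prod_X_sub_C_dvd_iff_le_roots hg, Multiset.le_iff_subset (legendre_roots n).2.1]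
    intro x hx
    rw [mem_roots hg, IsRoot.def, eval_sub, sub_eq_zero]
    exact (hr_eval x (Multiset.mem_toFinset.mpr hx)).symm
  obtain ⟨h, hh⟩ := hdvd
  have hn : 1 ≤ n := by omega
  have hh_deg : h.degree < n := by
    by_cases h0 : h = 0
    · rw [h0, degree_zero]; exact WithBot.bot_lt_coe n
    have hr_nat : r.natDegree < n := by
      by_cases hr0 : r = 0
      · rw [hr0, natDegree_zero]; omega
      · exact (natDegree_lt_iff_degree_lt hr0).mpr hr_deg
    have hfr : (f - r).natDegree < 2 * n :=
      (natDegree_sub_le f r).trans_lt (max_lt hf (by omega))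
    have hprod : (f - r).natDegree = n + h.natDegree := by
      rw [hh, natDegree_mul (legendre_ne_zero n) h0, natDegree_legendre]
    rw [degree_eq_natDegree h0, Nat.cast_lt]
    omega
  have hint_g : ∫ t in (-1 : ℝ)..1, (f - r).eval t = 0 := by
    simp only [hh, eval_mul]
    exact integral_legendre_mul_eq_zero hh_deg
  have hint_r : ∫ t in (-1 : ℝ)..1, r.eval t =
      ∑ x ∈ gaussLegendreNodes n, gaussLegendreWeight n x * f.eval x := by
    have hr_sum : ∀ t, r.eval t =
        ∑ x ∈ gaussLegendreNodes n, f.eval x * (gaussLegendreBasis n x).eval t := by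
      intro t
      rw [hr_def, Lagrange.interpolate_apply, eval_finsetSum]
      simp only [eval_mul, eval_C, gaussLegendreBasis]
    simp_rw [hr_sum]
    rw [intervalIntegral.integral_finsetSum]
    · refine Finset.sum_congr rfl fun x _ => ?_
      rw [intervalIntegral.integral_const_mul, gaussLegendreWeight, mul_comm]
    · intro x _
      exact (continuous_const.mul (Polynomial.continuous _)).intervalIntegrable _ _
  calc ∫ t in (-1 : ℝ)..1, f.eval t
      = ∫ t in (-1 : ℝ)..1, (r.eval t + (f - r).eval t) := by
        congr 1; ext t; simp
    _ = (∫ t in (-1 : ℝ)..1, r.eval t) + ∫ t in (-1 : ℝ)..1, (f - r).eval t :=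
        intervalIntegral.integral_add (r.continuous.intervalIntegrable _ _)
          ((f - r).continuous.intervalIntegrable _ _)
    _ = ∑ x ∈ gaussLegendreNodes n, gaussLegendreWeight n x * f.eval x := by
        rw [hint_g, add_zero, hint_r]

/-- **The Gauss–Legendre weights are positive** (Szegő Thm. 3.4.2; Castillo–Petronilho Thm. 3.4:
`0 < ∫ ℓ_x² = λ_x` by exactness applied to `ℓ_x²`, `deg ℓ_x² = 2n - 2`).
[cite: Szego1939, Thm. 3.4.2] [cite: CastilloPetronilho2024, Thm. 3.4] -/
theorem gaussLegendreWeight_pos {n : ℕ} {x : ℝ} (hx : x ∈ gaussLegendreNodes n) :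
    0 < gaussLegendreWeight n x := by
  classical
  have hcard : (gaussLegendreNodes n).card = n := card_gaussLegendreNodes n
  have hn : 1 ≤ n := by
    rw [← hcard]; exact Finset.card_pos.mpr ⟨x, hx⟩
  have hdeg : (gaussLegendreBasis n x ^ 2).natDegree < 2 * n := by
    rw [natDegree_pow, natDegree_gaussLegendreBasis hx]
    omega
  have hex := integral_eq_sum_gaussLegendreWeight_mul hdeg
  have hsum : ∑ y ∈ gaussLegendreNodes n,
      gaussLegendreWeight n y * (gaussLegendreBasis n x ^ 2).eval y = gaussLegendreWeight n x := by
    rw [Finset.sum_eq_single_of_mem x hx]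
    · rw [eval_pow, eval_gaussLegendreBasis_self hx, one_pow, mul_one]
    · intro y hy hyx
      rw [eval_pow, eval_gaussLegendreBasis_of_ne hy (Ne.symm hyx), zero_pow two_ne_zero,
        mul_zero]
  rw [← hsum, ← hex]
  have hxI : x ∈ Icc (-1 : ℝ) 1 := Ioo_subset_Icc_self (mem_Ioo_of_mem_gaussLegendreNodes hx)
  calc (0 : ℝ) = ∫ _ in (-1 : ℝ)..1, (0 : ℝ) := by simp
    _ < ∫ t in (-1 : ℝ)..1, (gaussLegendreBasis n x ^ 2).eval t :=
        intervalIntegral.integral_lt_integral_of_continuousOn_of_le_of_exists_lt (by norm_num)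
          continuousOn_const (Polynomial.continuous _).continuousOn
          (fun t _ => by rw [eval_pow]; positivity)
          ⟨x, hxI, by rw [eval_pow, eval_gaussLegendreBasis_self hx]; norm_num⟩

/-- **The Gauss–Legendre weights sum to `2 = ∫_{-1}^{1} 1`** (Castillo–Petronilho Thm. 3.4
eq. (3.24)). [cite: CastilloPetronilho2024, Thm. 3.4] -/
theorem sum_gaussLegendreWeight {n : ℕ} (hn : 1 ≤ n) :
    ∑ x ∈ gaussLegendreNodes n, gaussLegendreWeight n x = 2 := by
  have h := integral_eq_sum_gaussLegendreWeight_mul (n := n) (f := 1)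
    (by rw [natDegree_one]; omega)
  simp only [eval_one, mul_one, intervalIntegral.integral_const, smul_eq_mul] at h
  linarith

/-! ### Closed form of the Christoffel numbers -/

/-- **Closed form of the Gauss–Legendre weights**: for a node `x` (a zero of `P_n`),
`λ_x = 2 / ((1 - x²) P_n'(x)²)`.  Proof (Beu (10.66)–(10.71)): with `Q = P_n / (X - x)` one has
`Q(x) = P_n'(x)`, `Q` vanishes at the other nodes, and the polynomial identity
`Q² = 2 Q P_n' - (Q P_n)'`; integrating, exactness on `Q²` and on `Q P_n'` (both of degree
`2n - 2`) and `P_n(±1)² = 1` give `λ_x P_n'(x)² = 2 λ_x P_n'(x)² - 2/(1 - x²)`.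
[cite: AbramowitzStegun1964, 25.4.29] [cite: Beu2014, (10.71)] -/
theorem gaussLegendreWeight_eq {n : ℕ} {x : ℝ} (hx : x ∈ gaussLegendreNodes n) :
    gaussLegendreWeight n x = 2 / ((1 - x ^ 2) * ((derivative (legendre n)).eval x) ^ 2) := by
  have hroot : (legendre n).IsRoot x := mem_gaussLegendreNodes_iff.mp hx
  have hxI := mem_Ioo_of_mem_gaussLegendreNodes hx
  have hn : 1 ≤ n := by
    rcases Nat.eq_zero_or_pos n with rfl | h
    · simp [gaussLegendreNodes, legendre_zero] at hx
    · exact h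
  -- `Q = P_n / (X - x)`
  set Q : ℝ[X] := legendre n /ₘ (X - C x) with hQ_def
  have hPQ : (X - C x) * Q = legendre n := mul_divByMonic_eq_iff_isRoot.mpr hroot
  have hQdeg : Q.natDegree = n - 1 := by
    rw [hQ_def, natDegree_divByMonic _ (monic_X_sub_C x), natDegree_legendre, natDegree_X_sub_C]
  -- `P_n' = Q + (X - x) Q'`
  have hder : derivative (legendre n) = Q + (X - C x) * derivative Q := by
    rw [← hPQ, derivative_mul, derivative_X_sub_C, one_mul]
  have hQx : Q.eval x = (derivative (legendre n)).eval x := by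
    rw [hder, eval_add, eval_mul, eval_sub, eval_X, eval_C, sub_self, zero_mul, add_zero]
  have hQy : ∀ y ∈ gaussLegendreNodes n, y ≠ x → Q.eval y = 0 := by
    intro y hy hyx
    have h0 : (y - x) * Q.eval y = 0 := by
      have := congrArg (eval y) hPQ
      simpa [eval_mul, (mem_gaussLegendreNodes_iff.mp hy).eq_zero] using this
    rcases mul_eq_zero.mp h0 with h | h
    · exact absurd (sub_eq_zero.mp h) hyx
    · exact h
  -- values of `Q` at `±1`
  have hQ1 : Q.eval 1 = 1 / (1 - x) := by
    have h := congrArg (eval 1) hPQ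
    rw [eval_mul, eval_sub, eval_X, eval_C, eval_one_legendre] at h
    have hx1 : 1 - x ≠ 0 := (sub_pos.mpr hxI.2).ne'
    rw [eq_div_iff hx1, mul_comm]
    exact h
  have hQm1 : Q.eval (-1) * (legendre n).eval (-1) = 1 / (-1 - x) := by
    have h := congrArg (eval (-1)) hPQ
    rw [eval_mul, eval_sub, eval_X, eval_C] at h
    have hx1 : -1 - x ≠ 0 := (by linarith [hxI.1] : -1 - x < 0).ne
    have hsq : (legendre n).eval (-1) * (legendre n).eval (-1) = 1 := by
      rw [eval_neg_one_legendre, ← pow_add, ← two_mul, pow_mul]; norm_num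
    -- `Q(-1) P(-1) (-1 - x) = P(-1)² = 1`
    have : Q.eval (-1) * (legendre n).eval (-1) * (-1 - x) = 1 := by
      calc Q.eval (-1) * (legendre n).eval (-1) * (-1 - x)
          = ((-1 - x) * Q.eval (-1)) * (legendre n).eval (-1) := by ring
        _ = 1 := by rw [h, hsq]
    exact eq_div_of_mul_eq hx1 this
  -- the polynomial identity `Q² = 2 Q P' - (Q P)'`
  have hident : Q ^ 2 = 2 * (Q * derivative (legendre n)) - derivative (Q * legendre n) := by
    rw [← hPQ]
    simp only [derivative_mul, derivative_sub, derivative_X, derivative_C, sub_zero, one_mul]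
    ring
  -- exactness on `Q²` and on `Q P'`
  have hdeg1 : (Q ^ 2).natDegree < 2 * n := by
    calc (Q ^ 2).natDegree ≤ 2 * Q.natDegree := natDegree_pow_le
      _ < 2 * n := by rw [hQdeg]; omega
  have hdeg2 : (Q * derivative (legendre n)).natDegree < 2 * n := by
    calc (Q * derivative (legendre n)).natDegree
        ≤ Q.natDegree + (derivative (legendre n)).natDegree := natDegree_mul_le
      _ ≤ (n - 1) + (n - 1) := by
          rw [hQdeg]
          refine Nat.add_le_add_left ((natDegree_derivative_le _).trans ?_) _
          rw [natDegree_legendre]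
      _ < 2 * n := by omega
  have hsum1 : ∑ y ∈ gaussLegendreNodes n, gaussLegendreWeight n y * (Q ^ 2).eval y =
      gaussLegendreWeight n x * (derivative (legendre n)).eval x ^ 2 := by
    rw [Finset.sum_eq_single_of_mem x hx fun y hy hyx => by rw [eval_pow, hQy y hy hyx]; simp]
    rw [eval_pow, hQx]
  have hsum2 : ∑ y ∈ gaussLegendreNodes n,
      gaussLegendreWeight n y * (Q * derivative (legendre n)).eval y =
      gaussLegendreWeight n x * (derivative (legendre n)).eval x ^ 2 := by
    rw [Finset.sum_eq_single_of_mem x hx fun y hy hyx => by rw [eval_mul, hQy y hy hyx]; simp]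
    rw [eval_mul, hQx, sq]
  have hex1 := integral_eq_sum_gaussLegendreWeight_mul hdeg1
  have hex2 := integral_eq_sum_gaussLegendreWeight_mul hdeg2
  rw [hsum1] at hex1
  rw [hsum2] at hex2
  -- `∫ (Q P)' = (Q P)(1) - (Q P)(-1) = 2 / (1 - x²)`
  have hftc : ∫ t in (-1 : ℝ)..1, (derivative (Q * legendre n)).eval t =
      (Q * legendre n).eval 1 - (Q * legendre n).eval (-1) :=
    intervalIntegral.integral_eq_sub_of_hasDerivAt (fun t _ => (Q * legendre n).hasDerivAt t)
      ((Polynomial.continuous _).intervalIntegrable _ _)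
  have hbdry : (Q * legendre n).eval 1 - (Q * legendre n).eval (-1) = 2 / (1 - x ^ 2) := by
    rw [eval_mul, eval_mul, eval_one_legendre, mul_one, hQ1, hQm1]
    have hx1 : 1 - x ≠ 0 := (sub_pos.mpr hxI.2).ne'
    have hx2 : -1 - x ≠ 0 := (by linarith [hxI.1] : -1 - x < 0).ne
    have hx3 : 1 - x ^ 2 ≠ 0 := by
      rw [show 1 - x ^ 2 = -((1 - x) * (-1 - x)) by ring]
      exact neg_ne_zero.mpr (mul_ne_zero hx1 hx2)
    field_simp
    ring
  -- integrate the identity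
  have hint : ∫ t in (-1 : ℝ)..1, (Q ^ 2).eval t =
      2 * (∫ t in (-1 : ℝ)..1, (Q * derivative (legendre n)).eval t) -
        ∫ t in (-1 : ℝ)..1, (derivative (Q * legendre n)).eval t := by
    rw [← intervalIntegral.integral_const_mul, ← intervalIntegral.integral_sub]
    · refine intervalIntegral.integral_congr fun t _ => ?_
      simp only [hident, eval_sub, eval_mul, eval_ofNat]
    · exact (continuous_const.mul (Polynomial.continuous _)).intervalIntegrable _ _
    · exact (Polynomial.continuous _).intervalIntegrable _ _
  rw [hex1, hex2, hftc, hbdry] at hint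
  -- `λ P'(x)² = 2 / (1 - x²)`
  have hkey : gaussLegendreWeight n x * (derivative (legendre n)).eval x ^ 2 = 2 / (1 - x ^ 2) :=
    by linarith [hint]
  have hx3 : 0 < 1 - x ^ 2 := by nlinarith [hxI.1, hxI.2]
  have hd : (derivative (legendre n)).eval x ^ 2 ≠ 0 := by
    intro h0
    rw [h0, mul_zero] at hkey
    have : (0 : ℝ) < 2 / (1 - x ^ 2) := by positivity
    linarith
  rw [eq_div_iff (mul_ne_zero hx3.ne' hd)]
  calc gaussLegendreWeight n x * ((1 - x ^ 2) * (derivative (legendre n)).eval x ^ 2)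
      = (gaussLegendreWeight n x * (derivative (legendre n)).eval x ^ 2) * (1 - x ^ 2) := by ring
    _ = 2 := by rw [hkey, div_mul_cancel₀ _ hx3.ne']

/-- At a node, `P_n'(x) ≠ 0` (the zeros are simple). [cite: Szego1939, Thm. 3.3.1] -/
theorem eval_derivative_legendre_ne_zero_of_mem_gaussLegendreNodes {n : ℕ} {x : ℝ}
    (hx : x ∈ gaussLegendreNodes n) : (derivative (legendre n)).eval x ≠ 0 := by
  intro h0
  have h := gaussLegendreWeight_eq hx
  rw [h0] at h
  simp at h
  exact (gaussLegendreWeight_pos hx).ne' h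

end Literature.Analysis.SpecialFunctions
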